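import Mathlib.Topology.Compactification.OnePoint.ProjectiveLine
import Mathlib.GroupTheory.Sylow
import Mathlib.Algebra.CharP.Lemmas
import Mathlib.Algebra.CharP.Reduced
import Mathlib.LinearAlgebra.Matrix.CharP
import Mathlib.Algebra.Polynomial.Roots
import Mathlib.RingTheory.IntegralDomain
import Literature.NumberTheory.GaloisRepresentations.SerreProp16PGL2
import HarnessLib

/-!
# Finite subgroups of `PGL₂(k)` in characteristic `p`, I: `p`-elements, Sylow `p`-subgroups and
their fixed points on `ℙ¹(k)`

Topic `GroupTheory/SpecificGroups`; theorems plus small definitions (the Möbius action of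
`PGL₂(k)` on `OnePoint k`, translations, homotheties, the derivative at `∞`), no named facts.
This is the first part of Dickson's classification of the finite subgroups of `PGL₂(k)` whose
order is divisible by `p = char k` (the *`p`-irregular* subgroups), following the elementary
exposition of

* X. Faber, *Finite `p`-irregular subgroups of `PGL₂(k)`*, arXiv:1112.1999 = La Matematica **2**
  (2023) 479–522, §3 (fixed points), §4.1–4.4 (cyclic subgroups, `p`-groups, the Borel subgroup)
  and the first paragraph of §6 [Faber2011],

itself "devoted to following Dickson's arguments" in L. E. Dickson, *Linear groups with an
exposition of the Galois field theory* (Teubner 1901), Ch. XII, §§239–241 [Dickson1901].  The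
classification is the input "the classification of finite subgroups of `PGL₂(𝔽̄_q)` shows that
the projective image of `r̄_{π,ι}` contains `PSL₂(𝔽_{q^a})` (and is contained in
`PGL₂(𝔽_{q^a})`)" of Newton–Thorne, *Symmetric power functoriality, II*, Publ. IHES 134 (2021),
proof of Prop. 3.7 (p. 140) and, through [KW09a, Lemma 6.3], proof of Thm. 3.1 (p. 143)
[NewtonThorneIHES2021b]; its `p`-regular half (Serre 1972, Prop. 16) is the tree's
`Literature.NumberTheory.GaloisRepresentations.Serre1972.prop16`.

## Contents (all proved)

Throughout `k` is a field; `PGL(Fin 2, k)` acts on `OnePoint k = k ∪ {∞}` by Möbius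
transformations (`mulActionOnePoint`, transported from Mathlib's action on `ℙ k (Fin 2 → k)`
along `OnePoint.equivProjectivization`, so that `[g] • x = g • x` for Mathlib's
`OnePoint.instGLAction`, `mk_smul`).

* **At most two fixed points.** `eq_one_of_smul_eq_three`: an element of `PGL₂(k)` fixing three
  points of `ℙ¹(k)` is `1` (Faber §3); `eq_one_of_forall_smul_eq` (faithfulness).
* **The stabiliser of `∞`.** `transl β` (`z ↦ z + β`, an `AddChar k PGL₂(k)`), `homoth a`
  (`z ↦ a z`, `kˣ →* PGL₂(k)`), `homoth_mul_transl_mul_inv` (`δ_a τ_β δ_a⁻¹ = τ_{aβ}`),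
  `exists_eq_transl_mul_homoth` (every element fixing `∞` is `τ_β δ_a`, Faber §4.4
  `B(k) = {(α β; 0 1)}`), the derivative at `∞` `derivInfty`/`derivHom : Stab(∞) →* kˣ` with
  kernel the translations (`derivInfty_eq_one_iff`, Faber's `0 → U(k) → B(k) → kˣ → 1`).
* **`p`-elements** (`char k = p`). `existsUnique_smul_eq_of_pow_char_eq_one`: a non-identity
  `h` with `h ^ p = 1` has exactly one fixed point; `exists_two_smul_eq_of_natCast_ne_zero`: a
  non-identity `h` with `h ^ m = 1`, `p ∤ m`, has exactly two (Faber Lemma 3.1, Prop. 4.1; `k`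
  algebraically closed); `pow_char_eq_one_of_pow_char_pow_eq_one` (no elements of order `p²`);
  `orderOf_eq_char_of_dvd`: **element orders are `p` or prime to `p`**;
  `pow_char_eq_one_of_smul_eq_unique` (unique fixed point ⇒ `p`-element).
* **`p`-groups.** `exists_smul_eq_of_isPGroup`: a non-trivial finite `p`-subgroup fixes a point
  `x`, the only fixed point of each of its non-identity elements (Faber Lemma 4.3; here via the
  centre of `P`).
* **Sylow `p`-subgroups of a finite `H ≤ PGL₂(k)`** (`k` algebraically closed), normalised so
  that the Sylow `p`-subgroup `P ≠ 1` fixes `∞`: `sylow_eq_translSubgroup` (`P` = all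
  translations in `H`), `sylow_normalizer_eq_stabilizer` (`N_H(P) = Stab_H(∞)`, Faber §6),
  `sylow_normal_iff_stabilizer_eq_top`, `exists_ne_infty_sylow_le_stabilizer` and
  `sylow_inf_eq_bot` (other Sylow subgroups fix other points; Sylow subgroups meet trivially),
  `card_sylow_dvd_index_stabilizer_sub_one` (`|P| ∣ [H : Stab_H(∞)] - 1`, i.e.
  `|G| = |N|(1 + f p^m)`, Faber (6.0.2)), `card_stabilizer_eq_card_translSubgroup_mul` and
  `not_dvd_card_range_stabDeriv` (`|Stab_H(∞)| = |U_H| · |Λ|` with `Λ ≤ kˣ` of order prime to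
  `p`, Faber Prop. 4.8), and the coordinate-free `exists_forall_smul_eq_of_normal` /
  `exists_forall_smul_eq_of_sylow_normal`: **a non-trivial normal `p`-subgroup forces a common
  fixed point** (Faber Cor. 4.10) — the "`P ◁ H` ⇒ Borel" branch of Dickson's theorem.
* `card_dvd_card_sub_one_of_smul_eq`: the abstract count behind (6.0.2) (a finite group acting
  with all non-identity elements fixing exactly one common point `x₀` has order dividing
  `|X| - 1`).

## What is NOT here (the remaining parts of Faber §§4–6)

The Borel normal form `(1 Γ; 0 1) ⋊ (μ_n 0; 0 1)` with its stabiliser field `𝔽_Γ` (Props. 4.5,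
4.8), the normaliser of a maximal `p`-regular cyclic subgroup (Prop. 4.7), the counting
Lemma 6.3 (`Γ = 𝔽_q`, `Λ ⊇ (𝔽_qˣ)²`), §6.1 (`Λ = (𝔽_qˣ)²` ⇒ `PSL₂(𝔽_q)`; `q = 2` dihedral),
§6.2 (`Λ = 𝔽_qˣ` ⇒ `PGL₂(𝔽_q)` or `𝔄₅` for `(f, q) = (3, 3)`) and the assembled Theorem B /
the Newton–Thorne corollary; they build on this file.

## Mathlib

Used: `Matrix.ProjGenLinGroup` (`PGL(n, R)`, `mk`, `mk_eq_mk_iff`, `induction_on`), the actions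
on `ℙ K V` (`Projectivization.PGL.mk_smul_mk`) and on `OnePoint K`
(`OnePoint.instGLAction`, `smul_infty_eq_ite`, `smul_some_eq_ite`,
`Matrix.GeneralLinearGroup.fixpointPolynomial`, `upperRightHom`), `Sylow`
(`is_maximal'`, `smul_eq_iff_mem_normalizer`, `exists_smul_eq`), `IsPGroup.center_nontrivial`,
`sub_pow_char_pow_of_commute`, `Polynomial.eq_zero_of_natDegree_lt_card_of_eval_eq_zero'`.
Mathlib has no classification of finite subgroups of `PGL₂` in positive characteristic (searched
`Dickson`, `ProjGenLinGroup`, `IsParabolic`: only the `GL₂(ℝ)`-oriented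
`IsParabolic.smul_eq_self_iff`, which needs `2 ≠ 0`).  From the tree: `GL2.*` helpers and
`KleinGeometry.exists_lift_pow_eq_one` (`ProjectiveTypeSolvable/Proofs`),
`Serre1972.exists_conj_eq_diagonal_of_natCast_ne_zero`, `Serre1972.exists_ne_zero_mulVec_eq_zero`
(`SerreProp16PGL2`, `SerreSubgroupsGL2Fp`).

## References

* [Faber2011] X. Faber, *Finite p-irregular subgroups of PGL₂(k)*, arXiv:1112.1999 (2011);
  La Matematica 2 (2023), 479–522, doi:10.1007/s44007-023-00051-4 — §3 Lemma 3.1; §4.1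
  Prop. 4.1; §4.2 Lemma 4.3; §4.4 Prop. 4.8, Cor. 4.10; §6 first paragraph, (6.0.1)–(6.0.2)
  (read 2026-08-15, `lit read arxiv:1112.1999`, chunks p0007–p0010, p0016).
* [Dickson1901] L. E. Dickson, *Linear groups with an exposition of the Galois field theory*,
  Teubner (1901), Ch. XII §§239–241, doi:10.5962/bhl.title.22174.
* [NewtonThorneIHES2021b] J. Newton, J. A. Thorne, *Symmetric power functoriality for
  holomorphic modular forms, II*, Publ. Math. IHÉS 134 (2021), 117–152, proof of Prop. 3.7 and
  of Thm. 3.1 (arXiv:2009.07180v2, pp. 24, 27).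
-/

open scoped MatrixGroups OnePoint LinearAlgebra.Projectivization
open Matrix MulAction Polynomial

namespace Literature.GroupTheory.SpecificGroups.PGL2

open Literature.NumberTheory.GaloisRepresentations

variable {k : Type*} [Field k]

local notation "M₂" => Matrix (Fin 2) (Fin 2) k

/-! ### Matrix preliminaries (no action) -/

section Matrices

/-- The fixed-point polynomial `γ X² + (δ - α) X - β` of `g = (α β; γ δ)` has degree `≤ 2`.
[folklore] -/
theorem natDegree_fixpointPolynomial_le (g : GL (Fin 2) k) :
    g.fixpointPolynomial.natDegree ≤ 2 := by
  unfold Matrix.GeneralLinearGroup.fixpointPolynomial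
  compute_degree

/-- For `g` upper triangular (fixing `∞`) the fixed-point polynomial has degree `≤ 1`.
[folklore] -/
theorem natDegree_fixpointPolynomial_le_one {g : GL (Fin 2) k} (hg : g 1 0 = 0) :
    g.fixpointPolynomial.natDegree ≤ 1 := by
  unfold Matrix.GeneralLinearGroup.fixpointPolynomial
  rw [hg, map_zero, zero_mul, zero_add]
  compute_degree

/-- If the fixed-point polynomial of `g` vanishes then `g` is scalar, i.e. `[g] = 1`. [folklore] -/
theorem mk_eq_one_of_fixpointPolynomial_eq_zero {g : GL (Fin 2) k}
    (h : g.fixpointPolynomial = 0) : Matrix.ProjGenLinGroup.mk g = 1 := by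
  rw [Matrix.ProjGenLinGroup.mk_eq_one,
    Matrix.GeneralLinearGroup.mem_center_iff_val_mem_range_scalar]
  exact Matrix.GeneralLinearGroup.fixpointPolynomial_eq_zero_iff.mp h

/-- The diagonal matrix `diag(a, 1) ∈ GL₂(k)`, as a homomorphism `kˣ → GL₂(k)`. [folklore] -/
def diagGL : kˣ →* GL (Fin 2) k where
  toFun a := ⟨!![(a : k), 0; 0, 1], !![((a⁻¹ : kˣ) : k), 0; 0, 1],
    by simp [Matrix.one_fin_two],
    by simp [Matrix.one_fin_two]⟩
  map_one' := by
    ext i j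
    fin_cases i <;> fin_cases j <;> simp
  map_mul' a b := by
    ext i j
    fin_cases i <;> fin_cases j <;> simp

/-- Entries of `diagGL a`. [folklore] -/
@[simp] theorem diagGL_val (a : kˣ) : ((diagGL a : GL (Fin 2) k) : M₂) = !![(a : k), 0; 0, 1] :=
  rfl

/-- The **translation** `z ↦ z + β`, the class of `(1 β; 0 1)` (Mathlib `upperRightHom β`), as an
additive character `k → PGL₂(k)`. [folklore] -/
def transl : AddChar k PGL(Fin 2, k) :=
  Matrix.ProjGenLinGroup.mk.compAddChar Matrix.GeneralLinearGroup.upperRightHom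

/-- Unfolding of `transl`. [folklore] -/
theorem transl_apply (β : k) :
    transl β = Matrix.ProjGenLinGroup.mk (Matrix.GeneralLinearGroup.upperRightHom β) := rfl

/-- The **homothety** `z ↦ a z`, the class of `diag(a, 1)`, as a homomorphism `kˣ → PGL₂(k)`.
[folklore] -/
def homoth : kˣ →* PGL(Fin 2, k) := Matrix.ProjGenLinGroup.mk.comp diagGL

/-- Unfolding of `homoth`. [folklore] -/
theorem homoth_apply (a : kˣ) : homoth a = Matrix.ProjGenLinGroup.mk (diagGL a) := rfl

/-- The commutation rule `homoth a · transl β = transl (a β) · homoth a`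
(`diag(a,1) (1 β; 0 1) = (1 aβ; 0 1) diag(a,1)`). [folklore] -/
theorem homoth_mul_transl (a : kˣ) (β : k) :
    homoth a * transl β = transl (a * β) * homoth a := by
  rw [homoth_apply, transl_apply, transl_apply, ← map_mul, ← map_mul]
  congr 1
  ext i j
  fin_cases i <;> fin_cases j <;>
    simp [Matrix.GeneralLinearGroup.upperRightHom_apply]

/-- Conjugating a translation by a homothety: `homoth a · transl β · (homoth a)⁻¹ = transl (a β)`.
[folklore] -/
theorem homoth_mul_transl_mul_inv (a : kˣ) (β : k) :
    homoth a * transl β * (homoth a)⁻¹ = transl (a * β) := by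
  rw [homoth_mul_transl, mul_inv_cancel_right]

/-- Multiplying translations with homotheties:
`(transl β · homoth a)(transl β' · homoth a') = transl (β + a β') · homoth (a a')`. [folklore] -/
theorem transl_mul_homoth_mul (β β' : k) (a a' : kˣ) :
    transl β * homoth a * (transl β' * homoth a') = transl (β + a * β') * homoth (a * a') := by
  rw [AddChar.map_add_eq_mul, MonoidHom.map_mul, mul_assoc (transl β), ← mul_assoc (homoth a),
    homoth_mul_transl]
  simp only [mul_assoc]

/-- The ratio `g₀₀ / g₁₁` of the diagonal entries — for upper triangular `g`, the derivative at `∞`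
of the Möbius transformation `z ↦ (g₀₀ z + g₀₁) / g₁₁`; it only depends on the class of `g` in
`PGL₂(k)`. [folklore] -/
def derivInfty (h : PGL(Fin 2, k)) : k :=
  Quotient.liftOn' h (fun g : GL (Fin 2) k => g 0 0 / g 1 1) (by
    intro a b hab
    rw [QuotientGroup.leftRel_apply, Matrix.GeneralLinearGroup.center_eq_range_scalar] at hab
    obtain ⟨u, hu⟩ := hab
    have hb : b = a * Matrix.GeneralLinearGroup.scalar (Fin 2) u := by
      rw [hu, mul_inv_cancel_left]
    have hval : ((b : GL (Fin 2) k) : M₂) = (u : k) • (a : M₂) := by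
      rw [hb, GL2.coe_mul_scalar]
    change (a : M₂) 0 0 / (a : M₂) 1 1 = (b : M₂) 0 0 / (b : M₂) 1 1
    rw [hval, Matrix.smul_apply, Matrix.smul_apply, smul_eq_mul, smul_eq_mul,
      mul_div_mul_left _ _ u.ne_zero])

/-- `derivInfty [g] = g₀₀ / g₁₁`. [folklore] -/
theorem derivInfty_mk (g : GL (Fin 2) k) :
    derivInfty (Matrix.ProjGenLinGroup.mk g) = g 0 0 / g 1 1 := rfl

/-- `derivInfty (transl β · homoth a) = a`. [folklore] -/
@[simp] theorem derivInfty_transl_mul_homoth (β : k) (a : kˣ) :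
    derivInfty (transl β * homoth a) = a := by
  rw [homoth_apply, transl_apply, ← map_mul, derivInfty_mk]
  simp [Matrix.GeneralLinearGroup.upperRightHom_apply]

/-- `derivInfty (transl β) = 1`. [folklore] -/
@[simp] theorem derivInfty_transl (β : k) : derivInfty (transl β) = 1 := by
  have := derivInfty_transl_mul_homoth β 1
  rwa [map_one, mul_one, Units.val_one] at this

/-- `derivInfty (homoth a) = a`. [folklore] -/
@[simp] theorem derivInfty_homoth (a : kˣ) : derivInfty (homoth a) = a := by
  have := derivInfty_transl_mul_homoth 0 a
  rwa [AddChar.map_zero_eq_one, one_mul] at this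

end Matrices

/-! ### The Möbius action of `PGL₂(k)` on `ℙ¹(k) = OnePoint k` -/

section Action

variable [DecidableEq k]

/-- `PGL₂(k)` acts on `ℙ¹(k) = k ∪ {∞}` (`OnePoint k`) by Möbius transformations
`[α β; γ δ] · z = (α z + β) / (γ z + δ)`: Mathlib's action of `PGL(Fin 2, k)` on `ℙ k (Fin 2 → k)`
transported along `OnePoint.equivProjectivization` (`t ↦ [t : 1]`, `∞ ↦ [1 : 0]`), exactly as
Mathlib's `OnePoint.instGLAction` does for `GL (Fin 2) k`. [folklore] -/
instance mulActionOnePoint : MulAction PGL(Fin 2, k) (OnePoint k) :=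
  (OnePoint.equivProjectivization k).mulAction PGL(Fin 2, k)

/-- The transported action commutes with `OnePoint.equivProjectivization`. [folklore] -/
theorem equivProjectivization_smul (h : PGL(Fin 2, k)) (x : OnePoint k) :
    OnePoint.equivProjectivization k (h • x) = h • OnePoint.equivProjectivization k x := by
  rw [Equiv.smul_def, Equiv.apply_symm_apply]

omit [DecidableEq k] in
/-- On `ℙ k (Fin 2 → k)` the class `[g] ∈ PGL₂(k)` acts as `g`. [folklore] -/
theorem mk_smul_projectivization (g : GL (Fin 2) k) (x : ℙ k (Fin 2 → k)) :
    Matrix.ProjGenLinGroup.mk g • x = g • x := by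
  induction x using Projectivization.ind with
  | h v hv => rfl

/-- On `OnePoint k` the class `[g] ∈ PGL₂(k)` acts as the Möbius transformation of `g`
(Mathlib `OnePoint.instGLAction`, `OnePoint.smul_infty_eq_ite`, `OnePoint.smul_some_eq_ite`).
[folklore] -/
@[simp] theorem mk_smul (g : GL (Fin 2) k) (x : OnePoint k) :
    Matrix.ProjGenLinGroup.mk g • x = g • x := by
  apply (OnePoint.equivProjectivization k).injective
  rw [equivProjectivization_smul, OnePoint.equivProjectivization_smul, mk_smul_projectivization]

/-- `[g] · ∞ = ∞` iff `g` is upper triangular. [folklore] -/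
theorem mk_smul_infty_eq_self_iff (g : GL (Fin 2) k) :
    Matrix.ProjGenLinGroup.mk g • (∞ : OnePoint k) = ∞ ↔ g 1 0 = 0 := by
  rw [mk_smul, OnePoint.smul_infty_eq_self_iff]

/-- A point of `OnePoint k` is fixed by `g` iff the corresponding line of `k²` is an eigenline of
`g`. [folklore] -/
theorem smul_symm_mk_eq_iff (g : GL (Fin 2) k) {v : Fin 2 → k} (hv : v ≠ 0) :
    g • (OnePoint.equivProjectivization k).symm (Projectivization.mk k v hv) =
        (OnePoint.equivProjectivization k).symm (Projectivization.mk k v hv) ↔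
      ∃ a : k, (g : M₂) *ᵥ v = a • v := by
  rw [← (OnePoint.equivProjectivization k).injective.eq_iff, OnePoint.equivProjectivization_smul,
    Equiv.apply_symm_apply, ← mk_smul_projectivization, KleinGeometry.mk_smul_mk_eq_iff]

/-! ### A non-identity element has at most two fixed points -/

/-- A finite fixed point of `g` is a root of its fixed-point polynomial (Mathlib
`fixpointPolynomial_aeval_eq_zero_iff`). [folklore] -/
theorem eval_fixpointPolynomial_eq_zero {g : GL (Fin 2) k} {c : k}
    (h : g • ((c : k) : OnePoint k) = c) : g.fixpointPolynomial.eval c = 0 := by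
  rw [← Polynomial.coe_aeval_eq_eval]
  exact Matrix.GeneralLinearGroup.fixpointPolynomial_aeval_eq_zero_iff.mpr h

/-- An element of `GL₂(k)` fixing three distinct points of `k ⊆ ℙ¹(k)` is scalar. [folklore] -/
theorem mk_eq_one_of_smul_coe_eq_three {g : GL (Fin 2) k} {a b c : k} (hab : a ≠ b) (hac : a ≠ c)
    (hbc : b ≠ c) (ha : g • ((a : k) : OnePoint k) = a) (hb : g • ((b : k) : OnePoint k) = b)
    (hc : g • ((c : k) : OnePoint k) = c) : Matrix.ProjGenLinGroup.mk g = 1 := by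
  apply mk_eq_one_of_fixpointPolynomial_eq_zero
  refine Polynomial.eq_zero_of_natDegree_lt_card_of_eval_eq_zero' _ {a, b, c} ?_ ?_
  · intro i hi
    simp only [Finset.mem_insert, Finset.mem_singleton] at hi
    rcases hi with rfl | rfl | rfl
    · exact eval_fixpointPolynomial_eq_zero ha
    · exact eval_fixpointPolynomial_eq_zero hb
    · exact eval_fixpointPolynomial_eq_zero hc
  · rw [Finset.card_eq_three.mpr ⟨a, b, c, hab, hac, hbc, rfl⟩]
    exact lt_of_le_of_lt (natDegree_fixpointPolynomial_le g) (by norm_num)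

/-- An element of `GL₂(k)` fixing `∞` and two distinct points of `k` is scalar. [folklore] -/
theorem mk_eq_one_of_smul_infty_eq_of_smul_coe_eq {g : GL (Fin 2) k} {a b : k} (hab : a ≠ b)
    (hi : g • (∞ : OnePoint k) = ∞) (ha : g • ((a : k) : OnePoint k) = a)
    (hb : g • ((b : k) : OnePoint k) = b) : Matrix.ProjGenLinGroup.mk g = 1 := by
  apply mk_eq_one_of_fixpointPolynomial_eq_zero
  have h10 : g 1 0 = 0 := OnePoint.smul_infty_eq_self_iff.mp hi
  refine Polynomial.eq_zero_of_natDegree_lt_card_of_eval_eq_zero' _ {a, b} ?_ ?_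
  · intro i hi
    simp only [Finset.mem_insert, Finset.mem_singleton] at hi
    rcases hi with rfl | rfl
    · exact eval_fixpointPolynomial_eq_zero ha
    · exact eval_fixpointPolynomial_eq_zero hb
  · rw [Finset.card_pair hab]
    exact lt_of_le_of_lt (natDegree_fixpointPolynomial_le_one h10) one_lt_two

/-- **An element of `GL₂(k)` fixing three distinct points of `ℙ¹(k)` is scalar** (a non-scalar
`2 × 2` matrix has at most two eigenlines). [folklore] -/
theorem mk_eq_one_of_smul_eq_three {g : GL (Fin 2) k} {x y z : OnePoint k} (hxy : x ≠ y)
    (hxz : x ≠ z) (hyz : y ≠ z) (hx : g • x = x) (hy : g • y = y) (hz : g • z = z) :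
    Matrix.ProjGenLinGroup.mk g = 1 := by
  cases x with
  | infty =>
    cases y with
    | infty => exact absurd rfl hxy
    | coe b =>
      cases z with
      | infty => exact absurd rfl hxz
      | coe c =>
        exact mk_eq_one_of_smul_infty_eq_of_smul_coe_eq (fun h => hyz (by rw [h])) hx hy hz
  | coe a =>
    cases y with
    | infty =>
      cases z with
      | infty => exact absurd rfl hyz
      | coe c =>
        exact mk_eq_one_of_smul_infty_eq_of_smul_coe_eq (fun h => hxz (by rw [h])) hy hx hz
    | coe b =>
      cases z with
      | infty =>
        exact mk_eq_one_of_smul_infty_eq_of_smul_coe_eq (fun h => hxy (by rw [h])) hz hx hy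
      | coe c =>
        exact mk_eq_one_of_smul_coe_eq_three (fun h => hxy (by rw [h])) (fun h => hxz (by rw [h]))
          (fun h => hyz (by rw [h])) hx hy hz

/-- **A non-identity element of `PGL₂(k)` has at most two fixed points on `ℙ¹(k)`**: an element
fixing three distinct points is the identity (Faber 2011, §3: a non-trivial `s` "has either one
or two distinct fixed points in `ℙ¹(k)`"). [cite: Faber2011, §3] -/
theorem eq_one_of_smul_eq_three {h : PGL(Fin 2, k)} {x y z : OnePoint k} (hxy : x ≠ y)
    (hxz : x ≠ z) (hyz : y ≠ z) (hx : h • x = x) (hy : h • y = y) (hz : h • z = z) : h = 1 := by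
  induction h using Matrix.ProjGenLinGroup.induction_on with
  | mk g =>
    rw [mk_smul] at hx hy hz
    exact mk_eq_one_of_smul_eq_three hxy hxz hyz hx hy hz

/-- If `h ≠ 1` fixes the distinct points `x, y`, its fixed points are exactly `x` and `y`.
[folklore] -/
theorem smul_eq_self_iff_of_ne_one {h : PGL(Fin 2, k)} (h1 : h ≠ 1) {x y : OnePoint k}
    (hxy : x ≠ y) (hx : h • x = x) (hy : h • y = y) (z : OnePoint k) :
    h • z = z ↔ z = x ∨ z = y := by
  constructor
  · intro hz
    by_contra hne
    push Not at hne
    exact h1 (eq_one_of_smul_eq_three hxy (Ne.symm hne.1) (Ne.symm hne.2) hx hy hz)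
  · rintro (rfl | rfl)
    · exact hx
    · exact hy

/-- The action of `PGL₂(k)` on `ℙ¹(k)` is faithful: only the identity fixes `0`, `1` and `∞`.
[folklore] -/
theorem eq_one_of_forall_smul_eq (h : PGL(Fin 2, k)) (hh : ∀ x : OnePoint k, h • x = x) :
    h = 1 :=
  eq_one_of_smul_eq_three (x := ((0 : k) : OnePoint k)) (y := ((1 : k) : OnePoint k)) (z := ∞)
    (fun h01 => zero_ne_one (OnePoint.coe_eq_coe.mp h01)) (OnePoint.coe_ne_infty 0)
    (OnePoint.coe_ne_infty 1) (hh _) (hh _) (hh _)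

/-! ### Translations, homotheties and the stabiliser of `∞` -/

/-- `transl β` moves `z` to `z + β`. [folklore] -/
@[simp] theorem transl_smul_coe (β z : k) :
    transl β • ((z : k) : OnePoint k) = ((z + β : k) : OnePoint k) := by
  rw [transl_apply, mk_smul, OnePoint.smul_some_eq_ite]
  simp [Matrix.GeneralLinearGroup.upperRightHom_apply]

/-- `transl β` fixes `∞`. [folklore] -/
@[simp] theorem transl_smul_infty (β : k) : transl β • (∞ : OnePoint k) = ∞ := by
  rw [transl_apply, mk_smul, OnePoint.smul_infty_eq_self_iff]
  simp [Matrix.GeneralLinearGroup.upperRightHom_apply]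

/-- `β ↦ transl β` is injective. [folklore] -/
theorem transl_injective : Function.Injective (transl : k → PGL(Fin 2, k)) := by
  intro a b h
  have := congrArg (fun t : PGL(Fin 2, k) => t • ((0 : k) : OnePoint k)) h
  simpa using this

/-- `transl β = 1` iff `β = 0`. [folklore] -/
theorem transl_eq_one_iff {β : k} : transl β = 1 ↔ β = 0 := by
  rw [← AddChar.map_zero_eq_one transl]
  exact transl_injective.eq_iff

/-- `homoth a` moves `z` to `a z`. [folklore] -/
@[simp] theorem homoth_smul_coe (a : kˣ) (z : k) :
    homoth a • ((z : k) : OnePoint k) = ((a * z : k) : OnePoint k) := by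
  rw [homoth_apply, mk_smul, OnePoint.smul_some_eq_ite]
  simp

/-- `homoth a` fixes `∞`. [folklore] -/
@[simp] theorem homoth_smul_infty (a : kˣ) : homoth a • (∞ : OnePoint k) = ∞ := by
  rw [homoth_apply, mk_smul, OnePoint.smul_infty_eq_self_iff]
  simp

/-- `a ↦ homoth a` is injective. [folklore] -/
theorem homoth_injective : Function.Injective (homoth : kˣ → PGL(Fin 2, k)) := by
  intro a b h
  have := congrArg (fun t : PGL(Fin 2, k) => t • ((1 : k) : OnePoint k)) h
  simp only [homoth_smul_coe, mul_one, OnePoint.coe_eq_coe] at this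
  exact Units.ext this

/-- `transl β · homoth a` fixes `∞`. [folklore] -/
theorem transl_mul_homoth_smul_infty (β : k) (a : kˣ) :
    (transl β * homoth a) • (∞ : OnePoint k) = ∞ := by
  rw [mul_smul, homoth_smul_infty, transl_smul_infty]

/-- `transl β · homoth a` moves `z` to `a z + β`. [folklore] -/
theorem transl_mul_homoth_smul_coe (β : k) (a : kˣ) (z : k) :
    (transl β * homoth a) • ((z : k) : OnePoint k) = ((a * z + β : k) : OnePoint k) := by
  rw [mul_smul, homoth_smul_coe, transl_smul_coe]

/-- Uniqueness of the normal form: `transl β · homoth a = transl β' · homoth a'` iff `β = β'` and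
`a = a'`. [folklore] -/
theorem transl_mul_homoth_eq_iff {β β' : k} {a a' : kˣ} :
    transl β * homoth a = transl β' * homoth a' ↔ β = β' ∧ a = a' := by
  constructor
  · intro h
    have h0 := congrArg (fun t : PGL(Fin 2, k) => t • ((0 : k) : OnePoint k)) h
    have h1 := congrArg (fun t : PGL(Fin 2, k) => t • ((1 : k) : OnePoint k)) h
    simp only [transl_mul_homoth_smul_coe, mul_zero, zero_add, mul_one, OnePoint.coe_eq_coe]
      at h0 h1
    refine ⟨h0, Units.ext ?_⟩
    rw [h0] at h1
    exact add_right_cancel h1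
  · rintro ⟨rfl, rfl⟩
    rfl

/-- `transl β = homoth a` only for `β = 0`, `a = 1`. [folklore] -/
theorem transl_eq_homoth_iff (β : k) (a : kˣ) : transl β = homoth a ↔ β = 0 ∧ a = 1 := by
  have := (transl_mul_homoth_eq_iff (k := k) (β := β) (β' := 0) (a := 1) (a' := a))
  rwa [map_one, mul_one, AddChar.map_zero_eq_one, one_mul, eq_comm (a := (1 : kˣ))] at this

/-- `[g]` fixes `∞` iff `g₁₀ = 0`; then `g₀₀, g₁₁ ≠ 0`. [folklore] -/
theorem apply_ne_zero_of_mk_smul_infty_eq {g : GL (Fin 2) k}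
    (hg : Matrix.ProjGenLinGroup.mk g • (∞ : OnePoint k) = ∞) : g 0 0 ≠ 0 ∧ g 1 1 ≠ 0 := by
  rw [mk_smul_infty_eq_self_iff] at hg
  have hdet := GL2.det_ne_zero g
  rw [Matrix.det_fin_two, hg, mul_zero, sub_zero] at hdet
  exact ⟨left_ne_zero_of_mul hdet, right_ne_zero_of_mul hdet⟩

/-- **Normal form of the elements fixing `∞`**: an element of `PGL₂(k)` fixing `∞` is
`transl β · homoth a` with `a = derivInfty h` (its derivative at `∞`)
(Faber 2011, §4.4: `B(k) = {s : s.∞ = ∞} = {(α β; 0 1)}`). [cite: Faber2011, §4.4] -/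
theorem exists_eq_transl_mul_homoth {h : PGL(Fin 2, k)} (hh : h • (∞ : OnePoint k) = ∞) :
    ∃ (β : k) (a : kˣ), (a : k) = derivInfty h ∧ h = transl β * homoth a := by
  induction h using Matrix.ProjGenLinGroup.induction_on with
  | mk g =>
    obtain ⟨h00, h11⟩ := apply_ne_zero_of_mk_smul_infty_eq hh
    rw [mk_smul_infty_eq_self_iff] at hh
    refine ⟨g 0 1 / g 1 1, Units.mk0 (g 0 0 / g 1 1) (div_ne_zero h00 h11), rfl, ?_⟩
    rw [transl_apply, homoth_apply, ← map_mul, GL2.mk_eq_mk_iff_smul]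
    refine ⟨(Units.mk0 (g 1 1) h11)⁻¹, ?_⟩
    ext i j
    fin_cases i <;> fin_cases j <;>
      simp [Matrix.GeneralLinearGroup.upperRightHom_apply, hh] <;> field_simp

/-- The derivative at `∞` is multiplicative on elements fixing `∞`. [folklore] -/
theorem derivInfty_mul {h h' : PGL(Fin 2, k)} (hh : h • (∞ : OnePoint k) = ∞)
    (hh' : h' • (∞ : OnePoint k) = ∞) : derivInfty (h * h') = derivInfty h * derivInfty h' := by
  obtain ⟨β, a, -, rfl⟩ := exists_eq_transl_mul_homoth hh
  obtain ⟨β', a', -, rfl⟩ := exists_eq_transl_mul_homoth hh'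
  rw [transl_mul_homoth_mul, derivInfty_transl_mul_homoth, derivInfty_transl_mul_homoth,
    derivInfty_transl_mul_homoth, Units.val_mul]

/-- The derivative at `∞` of an element fixing `∞` is non-zero. [folklore] -/
theorem derivInfty_ne_zero {h : PGL(Fin 2, k)} (hh : h • (∞ : OnePoint k) = ∞) :
    derivInfty h ≠ 0 := by
  obtain ⟨β, a, -, rfl⟩ := exists_eq_transl_mul_homoth hh
  rw [derivInfty_transl_mul_homoth]
  exact a.ne_zero

/-- **Kernel of the derivative**: an element fixing `∞` has derivative `1` iff it is a
translation (Faber 2011, §4.4: `U(k) = ker π`). [cite: Faber2011, §4.4] -/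
theorem derivInfty_eq_one_iff {h : PGL(Fin 2, k)} (hh : h • (∞ : OnePoint k) = ∞) :
    derivInfty h = 1 ↔ ∃ β : k, h = transl β := by
  obtain ⟨β, a, -, rfl⟩ := exists_eq_transl_mul_homoth hh
  rw [derivInfty_transl_mul_homoth]
  constructor
  · intro ha1
    refine ⟨β, ?_⟩
    rw [show a = 1 from Units.ext ha1, map_one, mul_one]
  · rintro ⟨β', h'⟩
    have h'' : transl β * homoth a = transl β' * homoth 1 := by rw [map_one, mul_one]; exact h'
    rw [(transl_mul_homoth_eq_iff.mp h'').2, Units.val_one]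

/-- **The derivative at `∞`** as a homomorphism `Stab(∞) → kˣ` on the stabiliser of `∞` in
`PGL₂(k)` (Faber 2011, §4.4: the exact sequence `0 → U(k) → B(k) → kˣ → 1`, `π` "maps
`s = (α β; 0 1)` to the derivative of `s.z = α z + β`"). [cite: Faber2011, §4.4] -/
noncomputable def derivHom : stabilizer PGL(Fin 2, k) (∞ : OnePoint k) →* kˣ where
  toFun s := Units.mk0 (derivInfty (s : PGL(Fin 2, k))) (derivInfty_ne_zero s.2)
  map_one' := Units.ext (by
    change derivInfty (1 : PGL(Fin 2, k)) = 1
    rw [← map_one homoth, derivInfty_homoth, Units.val_one])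
  map_mul' s t := Units.ext (by
    change derivInfty ((s : PGL(Fin 2, k)) * (t : PGL(Fin 2, k))) =
      derivInfty (s : PGL(Fin 2, k)) * derivInfty (t : PGL(Fin 2, k))
    exact derivInfty_mul s.2 t.2)

/-- Unfolding of `derivHom`. [folklore] -/
@[simp] theorem coe_derivHom_apply (s : stabilizer PGL(Fin 2, k) (∞ : OnePoint k)) :
    (derivHom s : k) = derivInfty (s : PGL(Fin 2, k)) := rfl

/-- `transl β` lies in the stabiliser of `∞`. [folklore] -/
theorem transl_mem_stabilizer_infty (β : k) :
    transl β ∈ stabilizer PGL(Fin 2, k) (∞ : OnePoint k) := transl_smul_infty β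

/-- `homoth a` lies in the stabiliser of `∞`. [folklore] -/
theorem homoth_mem_stabilizer_infty (a : kˣ) :
    homoth a ∈ stabilizer PGL(Fin 2, k) (∞ : OnePoint k) := homoth_smul_infty a

/-- `derivHom (homoth a) = a`; in particular `derivHom` is onto `kˣ`. [folklore] -/
theorem derivHom_homoth (a : kˣ) :
    derivHom ⟨homoth a, homoth_mem_stabilizer_infty a⟩ = a :=
  Units.ext (by simp)

/-- `derivHom s = 1` iff `s` is a translation. [folklore] -/
theorem derivHom_eq_one_iff (s : stabilizer PGL(Fin 2, k) (∞ : OnePoint k)) :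
    derivHom s = 1 ↔ ∃ β : k, (s : PGL(Fin 2, k)) = transl β := by
  rw [← derivInfty_eq_one_iff s.2, ← coe_derivHom_apply, Units.val_eq_one]

/-- An element moving `∞` to a prescribed point: `∞ ↦ ∞` by `1`, `∞ ↦ c` by
`transl c · [0 1; 1 0]`. [folklore] -/
theorem exists_smul_infty_eq (x : OnePoint k) : ∃ t : PGL(Fin 2, k), t • (∞ : OnePoint k) = x := by
  cases x with
  | infty => exact ⟨1, one_smul _ _⟩
  | coe c =>
    have hw : (!![(0 : k), 1; 1, 0]).det ≠ 0 := by simp [Matrix.det_fin_two_of]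
    refine ⟨transl c * Matrix.ProjGenLinGroup.mk (Matrix.GeneralLinearGroup.mkOfDetNeZero _ hw), ?_⟩
    rw [mul_smul, mk_smul, OnePoint.smul_infty_eq_ite]
    simp [Matrix.GeneralLinearGroup.mkOfDetNeZero]

/-- **Fixed points of a unipotent class.** If `g = 1 + N` with `N ≠ 0`, `N² = 0`, then `[g]` has
exactly one fixed point on `ℙ¹(k)` — the kernel line of `N` (Faber 2011, §3: "if `s` has a unique
fixed point, we may conjugate to assume that `s.z = z + β`"; here the converse direction, over any
field). [cite: Faber2011, §3, Lemma 3.1] -/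
theorem existsUnique_smul_eq_of_sub_one_mul_self_eq_zero {g : GL (Fin 2) k}
    (hN0 : (g : M₂) - 1 ≠ 0) (hNN : ((g : M₂) - 1) * ((g : M₂) - 1) = 0) :
    ∃! x : OnePoint k, g • x = x := by
  set N : M₂ := (g : M₂) - 1 with hN
  have hg : (g : M₂) = 1 + N := by rw [hN]; abel
  obtain ⟨v, hv, hNv⟩ := Serre1972.exists_ne_zero_mulVec_eq_zero hN0 hNN
  set e := OnePoint.equivProjectivization k with he
  have hfix : ∀ (w : Fin 2 → k) (hw : w ≠ 0),
      g • e.symm (Projectivization.mk k w hw) = e.symm (Projectivization.mk k w hw) ↔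
        N *ᵥ w = 0 := by
    intro w hw
    rw [he, smul_symm_mk_eq_iff, hg]
    constructor
    · rintro ⟨a, ha⟩
      rw [add_mulVec, one_mulVec] at ha
      have hNw : N *ᵥ w = (a - 1) • w := by
        rw [sub_smul, one_smul, ← ha, add_sub_cancel_left]
      have h2 : ((a - 1) * (a - 1)) • w = 0 := by
        have h3 := congrArg (N *ᵥ ·) hNw
        simp only [mulVec_mulVec, hNN, zero_mulVec, mulVec_smul] at h3
        rw [hNw, smul_smul] at h3
        exact h3.symm
      have ha1 : a - 1 = 0 := mul_self_eq_zero.mp ((smul_eq_zero.mp h2).resolve_right hw)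
      rw [hNw, ha1, zero_smul]
    · intro hNw
      exact ⟨1, by rw [add_mulVec, one_mulVec, hNw, add_zero, one_smul]⟩
  refine ⟨e.symm (Projectivization.mk k v hv), (hfix v hv).mpr hNv, fun y hy => ?_⟩
  obtain ⟨w, hw, rfl⟩ : ∃ (w : Fin 2 → k) (hw : w ≠ 0),
      y = e.symm (Projectivization.mk k w hw) :=
    ⟨(e y).rep, (e y).rep_nonzero, by rw [Projectivization.mk_rep, Equiv.symm_apply_apply]⟩
  have hNw := (hfix w hw).mp hy
  obtain ⟨c, hc⟩ := Serre1972.exists_eq_smul_of_mulVec_eq_zero hN0 hv hNv hNw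
  congr 1
  rw [Projectivization.mk_eq_mk_iff']
  exact ⟨c, hc.symm⟩

/-- The class of a diagonal matrix `diag(d₀, d₁)`, `d₀ ≠ d₁`, fixes exactly `∞` and `0`.
[folklore] -/
theorem smul_eq_self_iff_of_eq_diagonal {D : GL (Fin 2) k} {d : Fin 2 → k}
    (hD : (D : M₂) = diagonal d) (hd : d 0 ≠ d 1) (z : OnePoint k) :
    D • z = z ↔ z = ∞ ∨ z = ((0 : k) : OnePoint k) := by
  have h00 : D 0 0 = d 0 := by rw [hD]; simp
  have h01 : D 0 1 = 0 := by rw [hD]; simp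
  have h10 : D 1 0 = 0 := by rw [hD]; simp
  have h11 : D 1 1 = d 1 := by rw [hD]; simp
  have hd1 : d 1 ≠ 0 := by
    have := GL2.det_ne_zero D
    rw [hD, det_diagonal, Fin.prod_univ_two] at this
    exact right_ne_zero_of_mul this
  cases z with
  | infty => simp [OnePoint.smul_infty_eq_self_iff, h10]
  | coe z =>
    rw [OnePoint.smul_some_eq_ite, h00, h01, h10, h11, zero_mul, zero_add, add_zero, if_neg hd1]
    simp only [OnePoint.coe_eq_coe, OnePoint.coe_ne_infty, false_or]
    rw [div_eq_iff hd1]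
    constructor
    · intro h
      have : (d 0 - d 1) * z = 0 := by rw [sub_mul, h]; ring
      exact (mul_eq_zero.mp this).resolve_left (sub_ne_zero.mpr hd)
    · rintro rfl
      rw [mul_zero, zero_mul]

end Action

/-! ### `p`-elements -/

section UnipotentMatrices

/-- A `2 × 2` matrix a power of which vanishes squares to zero (`tr N = det N = 0` and
Cayley–Hamilton). [folklore] -/
theorem mul_self_eq_zero_of_pow_eq_zero {N : M₂} {n : ℕ} (h : N ^ n = 0) : N * N = 0 := by
  have htr : N.trace = 0 := (Matrix.isNilpotent_trace_of_isNilpotent ⟨n, h⟩).eq_zero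
  have hdet : N.det = 0 := by
    rcases n with _ | n
    · rw [pow_zero] at h
      exact absurd h one_ne_zero
    · have : N.det ^ (n + 1) = 0 := by rw [← det_pow, h, det_zero]
      exact pow_eq_zero_iff (Nat.succ_ne_zero n) |>.mp this
  rw [GL2.cayley_hamilton_two, htr, hdet, zero_smul, zero_smul, sub_zero]

variable (p : ℕ) [Fact p.Prime] [CharP k p]

omit [Fact (Nat.Prime p)] in
/-- In characteristic `p`: if `(g - 1)² = 0` then `g ^ p = 1` (`(1 + N)^p = 1 + p N`). [folklore] -/
theorem pow_char_eq_one_of_sub_one_mul_self_eq_zero {g : GL (Fin 2) k}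
    (h : ((g : M₂) - 1) * ((g : M₂) - 1) = 0) : g ^ p = 1 := by
  apply Units.ext
  rw [Units.val_pow_eq_pow_val, Units.val_one]
  have key := GL2.smul_one_add_pow_of_mul_self_eq_zero ((g : M₂) - 1) h 1 p
  have hg : (1 : k) • (1 : M₂) + ((g : M₂) - 1) = g := by rw [one_smul]; abel
  rw [hg, one_pow, one_smul, one_pow, mul_one, CharP.cast_eq_zero k p, zero_smul, add_zero] at key
  exact key

/-- In characteristic `p`: if `g ^ p = 1` then `(g - 1)² = 0` (`(g - 1)^p = g^p - 1 = 0`, and a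
nilpotent `2 × 2` matrix squares to zero). [folklore] -/
theorem sub_one_mul_self_eq_zero_of_pow_char_eq_one {g : GL (Fin 2) k} (h : g ^ p = 1) :
    ((g : M₂) - 1) * ((g : M₂) - 1) = 0 := by
  apply mul_self_eq_zero_of_pow_eq_zero (n := p)
  rw [sub_pow_char_of_commute p (Commute.one_right (g : M₂)), one_pow, ← Units.val_pow_eq_pow_val,
    h, Units.val_one, sub_self]

/-- In characteristic `p`: if `g ^ (p ^ n) = 1` then `(g - 1)² = 0`. [folklore] -/
theorem sub_one_mul_self_eq_zero_of_pow_char_pow_eq_one {g : GL (Fin 2) k} {n : ℕ}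
    (h : g ^ p ^ n = 1) : ((g : M₂) - 1) * ((g : M₂) - 1) = 0 := by
  apply mul_self_eq_zero_of_pow_eq_zero (n := p ^ n)
  rw [sub_pow_char_pow_of_commute p n (Commute.one_right (g : M₂)), one_pow,
    ← Units.val_pow_eq_pow_val, h, Units.val_one, sub_self]

omit [Fact (Nat.Prime p)] in
/-- `transl β ^ p = 1`. [folklore] -/
theorem transl_pow_char (β : k) : transl β ^ p = 1 := by
  rw [← AddChar.map_nsmul_eq_pow, nsmul_eq_mul, CharP.cast_eq_zero, zero_mul,
    AddChar.map_zero_eq_one]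

end UnipotentMatrices

section CharPAction

variable [DecidableEq k] (p : ℕ) [Fact p.Prime] [CharP k p]

/-- **`p`-elements have exactly one fixed point** (`k` algebraically closed of characteristic `p`):
a non-identity `h ∈ PGL₂(k)` with `h ^ p = 1` fixes a unique point of `ℙ¹(k)` (Faber 2011,
Lemma 3.1, (2) ⇒ (1)). [cite: Faber2011, Lemma 3.1] -/
theorem existsUnique_smul_eq_of_pow_char_eq_one [IsAlgClosed k] {h : PGL(Fin 2, k)} (h1 : h ≠ 1)
    (hp : h ^ p = 1) : ∃! x : OnePoint k, h • x = x := by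
  obtain ⟨g, rfl, hg⟩ := KleinGeometry.exists_lift_pow_eq_one h (Fact.out : p.Prime).pos hp
  have hNN := sub_one_mul_self_eq_zero_of_pow_char_eq_one p hg
  have hN0 : (g : M₂) - 1 ≠ 0 := by
    intro h0
    apply h1
    rw [show g = 1 from Units.ext (sub_eq_zero.mp h0), map_one]
  simp only [mk_smul]
  exact existsUnique_smul_eq_of_sub_one_mul_self_eq_zero hN0 hNN

/-- **`p`-regular elements have exactly two fixed points** (`k` algebraically closed of
characteristic `p`): a non-identity `h` with `h ^ m = 1`, `p ∤ m`, fixes exactly two points of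
`ℙ¹(k)` — a lift is diagonalisable with distinct eigenvalues
(`Serre1972.exists_conj_eq_diagonal_of_natCast_ne_zero`) (Faber 2011, §4.1: "`G` is `p`-regular,
it fixes exactly two points of `ℙ¹(k)`"). [cite: Faber2011, Prop. 4.1] -/
theorem exists_two_smul_eq_of_natCast_ne_zero [IsAlgClosed k] {h : PGL(Fin 2, k)} (h1 : h ≠ 1)
    {m : ℕ} (hm0 : 0 < m) (hm : (m : k) ≠ 0) (hhm : h ^ m = 1) :
    ∃ x y : OnePoint k, x ≠ y ∧ ∀ z, h • z = z ↔ z = x ∨ z = y := by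
  obtain ⟨g, rfl, hg⟩ := KleinGeometry.exists_lift_pow_eq_one h hm0 hhm
  have hgc : g ∉ Subgroup.center (GL (Fin 2) k) := fun hc =>
    h1 (Matrix.ProjGenLinGroup.mk_eq_one.mpr hc)
  obtain ⟨Q, d, hd, hQ⟩ := Serre1972.exists_conj_eq_diagonal_of_natCast_ne_zero g hm hg hgc
  have hgD : Matrix.ProjGenLinGroup.mk g = Matrix.ProjGenLinGroup.mk Q *
      Matrix.ProjGenLinGroup.mk (Q⁻¹ * g * Q) * (Matrix.ProjGenLinGroup.mk Q)⁻¹ := by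
    rw [← map_mul, ← map_inv, ← map_mul]
    congr 1
    group
  refine ⟨Matrix.ProjGenLinGroup.mk Q • ∞, Matrix.ProjGenLinGroup.mk Q • ((0 : k) : OnePoint k),
    fun heq => OnePoint.infty_ne_coe 0 (smul_left_cancel _ heq), fun z => ?_⟩
  rw [hgD, mul_smul, mul_smul, smul_eq_iff_eq_inv_smul, mk_smul (Q⁻¹ * g * Q),
    smul_eq_self_iff_of_eq_diagonal hQ hd, inv_smul_eq_iff, inv_smul_eq_iff]

omit [DecidableEq k] in
/-- **No elements of order `p²`** (`k` algebraically closed of characteristic `p`): `h ^ (p ^ n) = 1`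
already forces `h ^ p = 1` — a lift `g` with `g ^ (p^n) = 1` has `(g - 1)² = 0`, so `g ^ p = 1`
(Faber 2011, §4.1: a cyclic subgroup of `p`-power order has order `p`). [cite: Faber2011, Prop. 4.1] -/
theorem pow_char_eq_one_of_pow_char_pow_eq_one [IsAlgClosed k] {h : PGL(Fin 2, k)} {n : ℕ}
    (hn : h ^ p ^ n = 1) : h ^ p = 1 := by
  rcases n with _ | n
  · rw [pow_zero, pow_one] at hn
    rw [hn, one_pow]
  · obtain ⟨g, rfl, hg⟩ := KleinGeometry.exists_lift_pow_eq_one h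
      (pow_pos (Fact.out : p.Prime).pos _) hn
    rw [← map_pow, pow_char_eq_one_of_sub_one_mul_self_eq_zero p
      (sub_one_mul_self_eq_zero_of_pow_char_pow_eq_one p hg), map_one]

/-- Powers of an element fixing `x` fix `x`. [folklore] -/
theorem pow_smul_eq_self {G X : Type*} [Monoid G] [MulAction G X] {g : G} {x : X} (h : g • x = x)
    (n : ℕ) : g ^ n • x = x := by
  induction n with
  | zero => rw [pow_zero, one_smul]
  | succ n ih => rw [pow_succ, mul_smul, h, ih]

/-- **Element orders in `PGL₂(k)` are `p` or prime to `p`** (`k` algebraically closed of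
characteristic `p`): an element of finite order divisible by `p` has order exactly `p`
(Faber 2011, Prop. 4.1: a non-trivial finite cyclic subgroup either has order `p` and a unique
fixed point, or is `p`-regular with exactly two fixed points). [cite: Faber2011, Prop. 4.1] -/
theorem orderOf_eq_char_of_dvd [IsAlgClosed k] {h : PGL(Fin 2, k)} (hfin : IsOfFinOrder h)
    (hdvd : p ∣ orderOf h) : orderOf h = p := by
  have pp : p.Prime := Fact.out
  have hpos : 0 < orderOf h := hfin.orderOf_pos
  obtain ⟨j, m, hm, hjm⟩ := Nat.exists_eq_pow_mul_and_not_dvd hpos.ne' p pp.ne_one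
  have hm0 : 0 < m := Nat.pos_of_ne_zero (by rintro rfl; rw [mul_zero] at hjm; exact hpos.ne' hjm)
  -- `(h ^ m) ^ p = 1`, so `orderOf h ∣ m p` and `j = 1`
  have hu : (h ^ m) ^ p = 1 := by
    apply pow_char_eq_one_of_pow_char_pow_eq_one p (n := j)
    rw [← pow_mul, mul_comm, ← hjm, pow_orderOf_eq_one]
  have hdvd' : orderOf h ∣ m * p := orderOf_dvd_of_pow_eq_one (by rw [pow_mul, hu])
  have hj1 : j = 1 := by
    have hj0 : j ≠ 0 := by
      rintro rfl
      rw [pow_zero, one_mul] at hjm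
      exact hm (hjm ▸ hdvd)
    have h' : p ^ j ∣ p ^ 1 := by
      rw [pow_one]
      have h'' : p ^ j * m ∣ p * m := by rw [← hjm, mul_comm p m]; exact hdvd'
      exact Nat.dvd_of_mul_dvd_mul_right hm0 h''
    have := (Nat.pow_dvd_pow_iff_le_right pp.one_lt).mp h'
    omega
  rw [hj1, pow_one] at hjm
  -- now `orderOf h = p m` with `p ∤ m`; the fixed points force `m = 1`
  by_contra hne
  have hm1 : m ≠ 1 := by
    rintro rfl
    rw [mul_one] at hjm
    exact hne hjm
  have hu1 : h ^ m ≠ 1 := by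
    intro h1
    have h2 := Nat.le_of_dvd hm0 (hjm ▸ orderOf_dvd_of_pow_eq_one h1)
    have h3 : 2 * m ≤ p * m := Nat.mul_le_mul_right m pp.two_le
    omega
  obtain ⟨x, hx, hxu⟩ := existsUnique_smul_eq_of_pow_char_eq_one p hu1 hu
  have hhx : h • x = x :=
    hxu (h • x) (show (h ^ m) • h • x = h • x by rw [← mul_smul, ← pow_succ, pow_succ', mul_smul, hx])
  have hv1 : h ^ p ≠ 1 := by
    intro h1
    have h2 : p * m ∣ p * 1 := by rw [mul_one, ← hjm]; exact orderOf_dvd_of_pow_eq_one h1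
    exact hm1 (Nat.dvd_one.mp (Nat.dvd_of_mul_dvd_mul_left pp.pos h2))
  have hvm : (h ^ p) ^ m = 1 := by rw [← pow_mul, ← hjm, pow_orderOf_eq_one]
  have hmk : (m : k) ≠ 0 := fun h0 => hm ((CharP.cast_eq_zero_iff k p m).mp h0)
  obtain ⟨y, z, hyz, hfix⟩ := exists_two_smul_eq_of_natCast_ne_zero hv1 hm0 hmk hvm
  have hvx : (h ^ p) • x = x := pow_smul_eq_self hhx p
  obtain ⟨w, hwx, hw⟩ : ∃ w, w ≠ x ∧ (h ^ p) • w = w := by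
    by_cases hyx : y = x
    · exact ⟨z, fun hzx => hyz (hyx.trans hzx.symm), (hfix z).mpr (Or.inr rfl)⟩
    · exact ⟨y, hyx, (hfix y).mpr (Or.inl rfl)⟩
  have hne' : h • w ≠ x := fun heq => hwx (smul_left_cancel h (heq.trans hhx.symm))
  have hperm : (h ^ p) • h • w = h • w := by
    rw [← mul_smul, ← pow_succ, pow_succ', mul_smul, hw]
  have hhw : h • w = w := by
    rcases (smul_eq_self_iff_of_ne_one hv1 hwx.symm hvx hw (h • w)).mp hperm with h' | h'
    · exact absurd h' hne'
    · exact h'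
  exact hwx (hxu w (pow_smul_eq_self hhw m))

/-- The dichotomy for non-identity elements of finite order (`k` algebraically closed of
characteristic `p`): either `h ^ p = 1` and `h` has a unique fixed point, or `p ∤ orderOf h` and
`h` has exactly two fixed points (Faber 2011, Lemma 3.1 with Prop. 4.1).
[cite: Faber2011, Lemma 3.1, Prop. 4.1] -/
theorem pow_char_eq_one_or_not_dvd_orderOf [IsAlgClosed k] {h : PGL(Fin 2, k)}
    (hfin : IsOfFinOrder h) (h1 : h ≠ 1) :
    (h ^ p = 1 ∧ ∃! x : OnePoint k, h • x = x) ∨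
      (¬ p ∣ orderOf h ∧ ∃ x y : OnePoint k, x ≠ y ∧ ∀ z, h • z = z ↔ z = x ∨ z = y) := by
  by_cases hdvd : p ∣ orderOf h
  · left
    have hp : h ^ p = 1 := by rw [← orderOf_eq_char_of_dvd p hfin hdvd, pow_orderOf_eq_one]
    exact ⟨hp, existsUnique_smul_eq_of_pow_char_eq_one p h1 hp⟩
  · right
    refine ⟨hdvd, exists_two_smul_eq_of_natCast_ne_zero h1 hfin.orderOf_pos ?_
      (pow_orderOf_eq_one h)⟩
    intro h0
    exact hdvd ((CharP.cast_eq_zero_iff k p _).mp h0)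

/-- A non-identity element of finite order with a unique fixed point is a `p`-element
(Faber 2011, Lemma 3.1, (1) ⇒ (2)). [cite: Faber2011, Lemma 3.1] -/
theorem pow_char_eq_one_of_smul_eq_unique [IsAlgClosed k] {h : PGL(Fin 2, k)}
    (hfin : IsOfFinOrder h) {x : OnePoint k} (hx : ∀ y, h • y = y → y = x) : h ^ p = 1 := by
  by_cases h1 : h = 1
  · rw [h1, one_pow]
  rcases pow_char_eq_one_or_not_dvd_orderOf p hfin h1 with ⟨hp, -⟩ | ⟨-, y, z, hyz, hfix⟩
  · exact hp
  · exact absurd ((hx y ((hfix y).mpr (Or.inl rfl))).trans (hx z ((hfix z).mpr (Or.inr rfl))).symm)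
      hyz

/-! ### Finite `p`-groups fix a unique point -/

/-- **A non-trivial finite `p`-subgroup of `PGL₂(k)` fixes exactly one point of `ℙ¹(k)`** (`k`
algebraically closed of characteristic `p`): all of `P` fixes a point `x`, and `x` is the only
fixed point of every non-identity element of `P` (Faber 2011, Lemma 4.3: "`G` is conjugate to a
group of the form `(1 Γ; 0 1)` … In particular, `G` fixes a unique point of `ℙ¹(k)`"; here via
the centre of `P`). [cite: Faber2011, Lemma 4.3] -/
theorem exists_smul_eq_of_isPGroup [IsAlgClosed k] {P : Subgroup PGL(Fin 2, k)} [Finite P]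
    (hP : IsPGroup p P) (hP1 : P ≠ ⊥) :
    ∃ x : OnePoint k, (∀ s ∈ P, s • x = x) ∧ ∀ s ∈ P, s ≠ 1 → ∀ y, s • y = y → y = x := by
  haveI : Nontrivial P := (Subgroup.nontrivial_iff_ne_bot P).mpr hP1
  haveI := hP.center_nontrivial
  obtain ⟨z, hz1⟩ := exists_ne (1 : Subgroup.center P)
  have hz1' : ((z : P) : PGL(Fin 2, k)) ≠ 1 := fun h1 => hz1 (Subtype.ext (Subtype.ext h1))
  obtain ⟨n, hn⟩ := hP (z : P)
  have hzp : ((z : P) : PGL(Fin 2, k)) ^ p = 1 := by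
    apply pow_char_eq_one_of_pow_char_pow_eq_one p (n := n)
    rw [← Subgroup.coe_pow, hn, Subgroup.coe_one]
  obtain ⟨x, hx, hxu⟩ := existsUnique_smul_eq_of_pow_char_eq_one p hz1' hzp
  have hfix : ∀ s ∈ P, s • x = x := by
    intro s hs
    have hcomm : (⟨s, hs⟩ : P) * (z : P) = (z : P) * ⟨s, hs⟩ :=
      Subgroup.mem_center_iff.mp z.2 ⟨s, hs⟩
    have hcomm' : s * ((z : P) : PGL(Fin 2, k)) = ((z : P) : PGL(Fin 2, k)) * s :=
      congrArg Subtype.val hcomm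
    apply hxu
    rw [← mul_smul, ← hcomm', mul_smul, hx]
  refine ⟨x, hfix, fun s hs hs1 y hy => ?_⟩
  obtain ⟨m, hm⟩ := hP ⟨s, hs⟩
  have hsp : s ^ p = 1 := by
    apply pow_char_eq_one_of_pow_char_pow_eq_one p (n := m)
    have := congrArg Subtype.val hm
    simpa using this
  obtain ⟨x', -, hxu'⟩ := existsUnique_smul_eq_of_pow_char_eq_one p hs1 hsp
  exact (hxu' y hy).trans (hxu' x (hfix s hs)).symm

/-! ### Sylow `p`-subgroups of a finite subgroup of `PGL₂(k)` -/

/-- **Free actions off one point**: if a finite group `G` acts on a finite set `X` fixing `x₀`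
and every non-identity element fixes only `x₀`, then `|G|` divides `|X| - 1` (the other orbits
are regular). [folklore] -/
theorem card_dvd_card_sub_one_of_smul_eq {G X : Type*} [Group G] [MulAction G X] [Finite G]
    [Finite X] (x₀ : X) (h₀ : ∀ g : G, g • x₀ = x₀)
    (h : ∀ (g : G) (x : X), g • x = x → g = 1 ∨ x = x₀) : Nat.card G ∣ Nat.card X - 1 := by
  classical
  let Y : SubMulAction G X :=
    ⟨{x | x ≠ x₀}, fun g x (hx : x ≠ x₀) => show g • x ≠ x₀ from fun hgx =>
      hx (smul_left_cancel g (hgx.trans (h₀ g).symm))⟩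
  have hY : Nat.card X = Nat.card Y + 1 := by
    rw [← Finite.card_option]
    exact (Nat.card_congr (Equiv.optionSubtypeNe x₀)).symm
  have hfree : ∀ y : Y, stabilizer G y = ⊥ := by
    intro y
    rw [Subgroup.eq_bot_iff_forall]
    intro g hg
    have hg' : g • (y : X) = y := by
      have := congrArg Subtype.val (mem_stabilizer_iff.mp hg)
      simpa using this
    rcases h g (y : X) hg' with h1 | h1
    · exact h1
    · exact absurd h1 y.2
  letI := Fintype.ofFinite (orbitRel.Quotient G Y)
  have hcard : Nat.card Y = Fintype.card (orbitRel.Quotient G Y) * Nat.card G := by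
    rw [Nat.card_congr (MulAction.selfEquivSigmaOrbits G Y), Nat.card_sigma]
    have : ∀ ω : orbitRel.Quotient G Y, Nat.card (orbit G ω.out) = Nat.card G := by
      intro ω
      rw [Nat.card_coe_set_eq, ← MulAction.index_stabilizer, hfree, Subgroup.index_bot]
    simp only [this, Finset.sum_const, Finset.card_univ, smul_eq_mul]
  rw [hY, Nat.add_sub_cancel, hcard]
  exact Dvd.intro_left _ rfl

section Finite

variable (H : Subgroup PGL(Fin 2, k)) [Finite H]

/-- The **translations lying in `H`**, a subgroup of `H`. [folklore] -/
def translSubgroup : Subgroup H := (transl (k := k)).toMonoidHom.range.subgroupOf H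

omit [DecidableEq k] [Fact (Nat.Prime p)] [CharP k p] [Finite H] in
/-- Membership in `translSubgroup`. [folklore] -/
theorem mem_translSubgroup_iff {s : H} :
    s ∈ translSubgroup H ↔ ∃ β : k, (s : PGL(Fin 2, k)) = transl β := by
  rw [translSubgroup, Subgroup.mem_subgroupOf, MonoidHom.mem_range]
  constructor
  · rintro ⟨a, ha⟩
    exact ⟨a.toAdd, ha.symm⟩
  · rintro ⟨β, hβ⟩
    exact ⟨Multiplicative.ofAdd β, hβ.symm⟩

omit [Fact (Nat.Prime p)] [CharP k p] [Finite H] in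
/-- Translations fix `∞`. [folklore] -/
theorem translSubgroup_le_stabilizer : translSubgroup H ≤ stabilizer H (∞ : OnePoint k) := by
  intro s hs
  obtain ⟨β, hβ⟩ := (mem_translSubgroup_iff H).mp hs
  rw [mem_stabilizer_iff, Subgroup.smul_def, hβ, transl_smul_infty]

omit [DecidableEq k] [Fact (Nat.Prime p)] [Finite H] in
/-- The translations in `H` form a `p`-group (of exponent `p`). [folklore] -/
theorem isPGroup_translSubgroup : IsPGroup p (translSubgroup H) := by
  intro s
  refine ⟨1, ?_⟩
  obtain ⟨β, hβ⟩ := (mem_translSubgroup_iff H).mp s.2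
  rw [pow_one]
  apply Subtype.ext
  apply Subtype.ext
  change ((s : H) : PGL(Fin 2, k)) ^ p = 1
  rw [hβ, transl_pow_char]

omit [Finite H] in
/-- Conjugating a translation of `H` by an element of `H` fixing `∞` gives a translation
(`U(k)` is normal in `B(k)`: `(transl γ · homoth a) transl β (transl γ · homoth a)⁻¹ = transl (aβ)`).
[cite: Faber2011, §4.4] -/
theorem conj_mem_translSubgroup {s t : H} (hs : s ∈ stabilizer H (∞ : OnePoint k))
    (ht : t ∈ translSubgroup H) : s * t * s⁻¹ ∈ translSubgroup H := by
  rw [mem_translSubgroup_iff] at ht ⊢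
  obtain ⟨β, hβ⟩ := ht
  rw [mem_stabilizer_iff, Subgroup.smul_def] at hs
  obtain ⟨γ, a, -, hsa⟩ := exists_eq_transl_mul_homoth hs
  refine ⟨a * β, ?_⟩
  rw [Subgroup.coe_mul, Subgroup.coe_mul, Subgroup.coe_inv, hβ, hsa]
  calc transl γ * homoth a * transl β * (transl γ * homoth a)⁻¹
      = transl γ * (homoth a * transl β * (homoth a)⁻¹) * (transl γ)⁻¹ := by group
    _ = transl γ * transl (a * β) * (transl γ)⁻¹ := by rw [homoth_mul_transl_mul_inv]
    _ = transl (a * β) := by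
        rw [← AddChar.map_neg_eq_inv, ← AddChar.map_add_eq_mul, ← AddChar.map_add_eq_mul]
        congr 1
        ring

omit [Finite H] in
/-- **A `p`-subgroup of `H` fixing `∞` consists of translations**: on it the derivative at `∞`
is a homomorphism to `kˣ` killed by a power of `p`, hence trivial (Faber 2011, §4.2/§4.4: a
`p`-group fixing `∞` is `(1 Γ; 0 1)`). [cite: Faber2011, Lemma 4.3] -/
theorem le_translSubgroup_of_isPGroup {Q : Subgroup H} (hQ : IsPGroup p Q)
    (hQi : Q ≤ stabilizer H (∞ : OnePoint k)) : Q ≤ translSubgroup H := by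
  intro s hs
  have hsi : (s : PGL(Fin 2, k)) • (∞ : OnePoint k) = ∞ := by
    have := hQi hs
    rwa [mem_stabilizer_iff, Subgroup.smul_def] at this
  obtain ⟨n, hn⟩ := hQ ⟨s, hs⟩
  have hsn : (s : PGL(Fin 2, k)) ^ p ^ n = 1 := by
    have := congrArg (fun t : Q => ((t : H) : PGL(Fin 2, k))) hn
    simpa using this
  rw [mem_translSubgroup_iff, ← derivInfty_eq_one_iff hsi]
  set s' : stabilizer PGL(Fin 2, k) (∞ : OnePoint k) := ⟨(s : PGL(Fin 2, k)), hsi⟩ with hs'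
  have h1 : s' ^ p ^ n = 1 := Subtype.ext (by rw [hs', Subgroup.coe_pow, hsn, Subgroup.coe_one])
  have h2 := map_pow derivHom s' (p ^ n)
  rw [h1, map_one] at h2
  have h3 := congrArg (fun u : kˣ => (u : k)) h2
  simp only [Units.val_one, Units.val_pow_eq_pow_val, coe_derivHom_apply] at h3
  -- `x ^ (p ^ n) = 1` forces `x = 1` in characteristic `p` (Frobenius is injective)
  haveI := ExpChar.prime (R := k) (Fact.out : p.Prime)
  have h4 := (ExpChar.pow_prime_pow_mul_eq_one_iff p n 1 (derivInfty (s : PGL(Fin 2, k)))).mp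
    (by rw [mul_one]; exact h3.symm)
  rwa [pow_one] at h4

omit [Finite H] in
/-- **A Sylow `p`-subgroup fixing `∞` is the group of all translations in `H`** (Sylow
maximality). [cite: Faber2011, §6, first paragraph] -/
theorem sylow_eq_translSubgroup (P : Sylow p H)
    (hPi : (P : Subgroup H) ≤ stabilizer H (∞ : OnePoint k)) :
    (P : Subgroup H) = translSubgroup H :=
  (P.is_maximal' (isPGroup_translSubgroup p H) (le_translSubgroup_of_isPGroup p H P.isPGroup' hPi)).symm

omit [Finite H] in
/-- A non-identity element of a Sylow `p`-subgroup fixing `∞` fixes only `∞`. [folklore] -/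
theorem eq_infty_of_mem_sylow_of_smul_eq [IsAlgClosed k] (P : Sylow p H)
    (hPi : (P : Subgroup H) ≤ stabilizer H (∞ : OnePoint k)) {u : H} (hu : u ∈ (P : Subgroup H))
    (hu1 : u ≠ 1) {y : OnePoint k} (hy : (u : PGL(Fin 2, k)) • y = y) : y = ∞ := by
  have hu1' : (u : PGL(Fin 2, k)) ≠ 1 := fun h => hu1 (Subtype.ext h)
  obtain ⟨m, hm⟩ := P.isPGroup' ⟨u, hu⟩
  have hup : (u : PGL(Fin 2, k)) ^ p = 1 :=
    pow_char_eq_one_of_pow_char_pow_eq_one p (n := m)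
      (by simpa using congrArg (fun t : (P : Subgroup H) => ((t : H) : PGL(Fin 2, k))) hm)
  obtain ⟨x, -, hxu⟩ := existsUnique_smul_eq_of_pow_char_eq_one p hu1' hup
  have hui : (u : PGL(Fin 2, k)) • (∞ : OnePoint k) = ∞ := by
    have := hPi hu
    rwa [mem_stabilizer_iff, Subgroup.smul_def] at this
  exact (hxu y hy).trans (hxu ∞ hui).symm

omit [Finite H] in
/-- **The normaliser of a Sylow `p`-subgroup is the stabiliser of its fixed point** (`k`
algebraically closed of characteristic `p`, `H ≤ PGL₂(k)` finite, `P ≠ 1` a Sylow `p`-subgroup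
fixing `∞`): `N_H(P) = Stab_H(∞)` (Faber 2011, §6: "`N = N_G(P)` … may be characterized as the
largest subgroup of `G` that fixes `∞`"). [cite: Faber2011, §6, first paragraph] -/
theorem sylow_normalizer_eq_stabilizer [IsAlgClosed k] (P : Sylow p H) (hP1 : (P : Subgroup H) ≠ ⊥)
    (hPi : (P : Subgroup H) ≤ stabilizer H (∞ : OnePoint k)) :
    Subgroup.normalizer ((P : Subgroup H) : Set H) = stabilizer H (∞ : OnePoint k) := by
  apply le_antisymm
  · intro n hn
    obtain ⟨⟨u, hu⟩, hu1⟩ := Subgroup.ne_bot_iff_exists_ne_one.mp hP1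
    have hu1' : u ≠ 1 := fun h => hu1 (Subtype.ext h)
    have hu' : n⁻¹ * u * n ∈ (P : Subgroup H) := by
      refine (Subgroup.mem_normalizer_iff.mp hn (n⁻¹ * u * n)).mpr ?_
      simpa [mul_assoc] using hu
    have h1 : (u : PGL(Fin 2, k)) • ((n : PGL(Fin 2, k)) • (∞ : OnePoint k)) =
        (n : PGL(Fin 2, k)) • ∞ := by
      have h2 : ((n⁻¹ * u * n : H) : PGL(Fin 2, k)) • (∞ : OnePoint k) = ∞ := by
        have := hPi hu'
        rwa [mem_stabilizer_iff, Subgroup.smul_def] at this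
      rw [Subgroup.coe_mul, Subgroup.coe_mul, Subgroup.coe_inv, mul_smul, mul_smul,
        inv_smul_eq_iff] at h2
      exact h2
    rw [mem_stabilizer_iff, Subgroup.smul_def]
    exact eq_infty_of_mem_sylow_of_smul_eq p H P hPi hu hu1' h1
  · intro s hs
    rw [Subgroup.mem_normalizer_iff]
    intro t
    rw [sylow_eq_translSubgroup p H P hPi]
    constructor
    · exact conj_mem_translSubgroup H hs
    · intro ht
      have := conj_mem_translSubgroup H (inv_mem hs) ht
      simpa [mul_assoc] using this

omit [Finite H] in
/-- **A normal Sylow `p`-subgroup means `H` fixes a point**: `P ◁ H` iff all of `H` fixes `∞`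
(for `P ≠ 1` a Sylow `p`-subgroup fixing `∞`) (Faber 2011, Cor. 4.10 / §6: "If `P` is normal,
then `N = G` is a subset of the standard Borel subgroup"). [cite: Faber2011, Cor. 4.10] -/
theorem sylow_normal_iff_stabilizer_eq_top [IsAlgClosed k] (P : Sylow p H)
    (hP1 : (P : Subgroup H) ≠ ⊥) (hPi : (P : Subgroup H) ≤ stabilizer H (∞ : OnePoint k)) :
    (P : Subgroup H).Normal ↔ stabilizer H (∞ : OnePoint k) = ⊤ := by
  rw [← sylow_normalizer_eq_stabilizer p H P hP1 hPi, Subgroup.normalizer_eq_top_iff]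

/-- **Distinct Sylow `p`-subgroups have distinct fixed points**: a Sylow `p`-subgroup `Q ≠ P`
fixes a point `y ≠ ∞` (Faber 2011, §6: "If `Q` is another Sylow `p`-subgroup, then `Q` fixes a
unique point `x ∈ ℙ¹(k) ∖ {∞}`"). [cite: Faber2011, §6, first paragraph] -/
theorem exists_ne_infty_sylow_le_stabilizer [IsAlgClosed k] (P Q : Sylow p H)
    (hP1 : (P : Subgroup H) ≠ ⊥) (hPi : (P : Subgroup H) ≤ stabilizer H (∞ : OnePoint k))
    (hQP : Q ≠ P) : ∃ y : OnePoint k, y ≠ ∞ ∧ (Q : Subgroup H) ≤ stabilizer H y := by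
  obtain ⟨g, rfl⟩ := MulAction.exists_smul_eq H P Q
  refine ⟨(g : PGL(Fin 2, k)) • ∞, ?_, ?_⟩
  · intro hg
    apply hQP
    rw [Sylow.smul_eq_iff_mem_normalizer]
    change g ∈ Subgroup.normalizer ((P : Subgroup H) : Set H)
    rw [sylow_normalizer_eq_stabilizer p H P hP1 hPi, mem_stabilizer_iff, Subgroup.smul_def]
    exact hg
  · intro t ht
    rw [Sylow.coe_subgroup_smul, Subgroup.mem_smul_pointwise_iff_exists] at ht
    obtain ⟨s, hs, rfl⟩ := ht
    have hsi : (s : PGL(Fin 2, k)) • (∞ : OnePoint k) = ∞ := by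
      have := hPi hs
      rwa [mem_stabilizer_iff, Subgroup.smul_def] at this
    rw [mem_stabilizer_iff, Subgroup.smul_def, MulAut.smul_def, MulAut.conj_apply, Subgroup.coe_mul,
      Subgroup.coe_mul, Subgroup.coe_inv, mul_smul, mul_smul, inv_smul_smul, hsi]

/-- **Sylow `p`-subgroups intersect trivially** (a non-identity `p`-element fixes only one
point). [cite: Faber2011, §6, first paragraph] -/
theorem sylow_inf_eq_bot [IsAlgClosed k] (P Q : Sylow p H) (hP1 : (P : Subgroup H) ≠ ⊥)
    (hPi : (P : Subgroup H) ≤ stabilizer H (∞ : OnePoint k)) (hQP : Q ≠ P) :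
    (P : Subgroup H) ⊓ Q = ⊥ := by
  obtain ⟨y, hy, hQy⟩ := exists_ne_infty_sylow_le_stabilizer p H P Q hP1 hPi hQP
  rw [Subgroup.eq_bot_iff_forall]
  rintro t ⟨htP, htQ⟩
  by_contra ht1
  have hty : (t : PGL(Fin 2, k)) • y = y := by
    have := hQy htQ
    rwa [mem_stabilizer_iff, Subgroup.smul_def] at this
  exact hy (eq_infty_of_mem_sylow_of_smul_eq p H P hPi htP ht1 hty)

/-- **The number of Sylow `p`-subgroups is `≡ 1 (mod |P|)`**, in the form: `|P|` divides
`[H : Stab_H(∞)] - 1` (`P` acts freely on the other points of the orbit of `∞`; Faber 2011,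
§6, (6.0.1)–(6.0.2): "`|G| = |N| · (1 + f p^m)`"). [cite: Faber2011, §6, (6.0.2)] -/
theorem card_sylow_dvd_index_stabilizer_sub_one [IsAlgClosed k] (P : Sylow p H)
    (hPi : (P : Subgroup H) ≤ stabilizer H (∞ : OnePoint k)) :
    Nat.card (P : Subgroup H) ∣ (stabilizer H (∞ : OnePoint k)).index - 1 := by
  set S := stabilizer H (∞ : OnePoint k) with hS
  rw [Subgroup.index]
  refine card_dvd_card_sub_one_of_smul_eq (G := (P : Subgroup H)) (X := H ⧸ S)
    ((1 : H) : H ⧸ S) ?_ ?_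
  · intro g
    change (((g : H) * 1 : H) : H ⧸ S) = ((1 : H) : H ⧸ S)
    rw [QuotientGroup.eq, mul_one, mul_one]
    exact hPi (inv_mem g.2)
  · intro g x hgx
    induction x using QuotientGroup.induction_on with
    | H h =>
      by_cases hg1 : g = 1
      · exact Or.inl hg1
      · right
        change (((g : H) * h : H) : H ⧸ S) = (h : H ⧸ S) at hgx
        rw [QuotientGroup.eq, _root_.mul_inv_rev] at hgx
        have hg1' : ((g : H) : H) ≠ 1 := fun h' => hg1 (Subtype.ext h')
        have h1 : ((h⁻¹ * ((g : H) : H)⁻¹ * h : H) : PGL(Fin 2, k)) • (∞ : OnePoint k) = ∞ := by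
          have : h⁻¹ * ((g : H) : H)⁻¹ * h ∈ stabilizer H (∞ : OnePoint k) := hgx
          rwa [mem_stabilizer_iff, Subgroup.smul_def] at this
        rw [Subgroup.coe_mul, Subgroup.coe_mul, Subgroup.coe_inv, Subgroup.coe_inv, mul_smul,
          mul_smul, inv_smul_eq_iff, inv_smul_eq_iff] at h1
        have h2 := eq_infty_of_mem_sylow_of_smul_eq p H P hPi g.2 hg1' h1.symm
        rw [QuotientGroup.eq, mul_one]
        exact inv_mem (show h ∈ stabilizer H (∞ : OnePoint k) by
          rw [mem_stabilizer_iff, Subgroup.smul_def]; exact h2)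

/-! ### The structure of the stabiliser of `∞` in `H` -/

omit [Fact (Nat.Prime p)] [CharP k p] [Finite H] in
/-- The inclusion of `Stab_H(∞)` in the stabiliser of `∞` in `PGL₂(k)`. [folklore] -/
def stabilizerInclusion :
    stabilizer H (∞ : OnePoint k) →* stabilizer PGL(Fin 2, k) (∞ : OnePoint k) :=
  (H.subtype.comp (stabilizer H (∞ : OnePoint k)).subtype).codRestrict _ fun s => by
    have := s.2
    rw [mem_stabilizer_iff, Subgroup.smul_def] at this
    exact this

omit [Fact (Nat.Prime p)] [CharP k p] [Finite H] in
/-- **The derivative at `∞` on `Stab_H(∞)`**, `s ↦ a` for `s = transl β · homoth a`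
(Faber 2011, §4.4: `π : B_G → π(B_G)`). [cite: Faber2011, §4.4] -/
noncomputable def stabDeriv : stabilizer H (∞ : OnePoint k) →* kˣ :=
  derivHom.comp (stabilizerInclusion H)

omit [Fact (Nat.Prime p)] [CharP k p] [Finite H] in
/-- Unfolding of `stabDeriv`. [folklore] -/
@[simp] theorem coe_stabDeriv_apply (s : stabilizer H (∞ : OnePoint k)) :
    (stabDeriv H s : k) = derivInfty ((s : H) : PGL(Fin 2, k)) := rfl

omit [Fact (Nat.Prime p)] [CharP k p] [Finite H] in
/-- **The kernel of the derivative is the group of translations** (Faber 2011, §4.4: the exact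
sequence `0 → U_G → B_G → π(B_G) → 1`). [cite: Faber2011, §4.4] -/
theorem mem_ker_stabDeriv_iff (s : stabilizer H (∞ : OnePoint k)) :
    s ∈ (stabDeriv H).ker ↔ (s : H) ∈ translSubgroup H := by
  have hs : ((s : H) : PGL(Fin 2, k)) • (∞ : OnePoint k) = ∞ := by
    have := s.2
    rwa [mem_stabilizer_iff, Subgroup.smul_def] at this
  rw [MonoidHom.mem_ker, mem_translSubgroup_iff, ← derivInfty_eq_one_iff hs, ← coe_stabDeriv_apply,
    Units.val_eq_one]

omit [Fact (Nat.Prime p)] [CharP k p] [Finite H] in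
/-- The kernel of `stabDeriv` is `translSubgroup H` (viewed inside `Stab_H(∞)`). [folklore] -/
theorem ker_stabDeriv :
    (stabDeriv H).ker = (translSubgroup H).subgroupOf (stabilizer H (∞ : OnePoint k)) := by
  ext s
  rw [mem_ker_stabDeriv_iff, Subgroup.mem_subgroupOf]

omit [Fact (Nat.Prime p)] [CharP k p] [Finite H] in
/-- **`|Stab_H(∞)| = |U_H| · |Λ|`**: the order of the stabiliser of `∞` is the number of
translations in `H` times the order of the image `Λ ≤ kˣ` of the derivative (Faber 2011, §4.4:
`B_G ≅ Γ ⋊ π(B_G)`). [cite: Faber2011, §4.4, Prop. 4.8] -/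
theorem card_stabilizer_eq_card_translSubgroup_mul :
    Nat.card (stabilizer H (∞ : OnePoint k)) =
      Nat.card (translSubgroup H) * Nat.card (stabDeriv H).range := by
  have hle := translSubgroup_le_stabilizer H
  rw [← Subgroup.index_ker, ker_stabDeriv,
    ← Nat.card_congr (Subgroup.subgroupOfEquivOfLe hle).toEquiv]
  exact (Subgroup.card_mul_index _).symm

/-- **The image `Λ ≤ kˣ` of the derivative has order prime to `p`** (it is a finite, hence cyclic,
subgroup of `kˣ`, and `kˣ` has no element of order `p`). [cite: Faber2011, §4.4, Prop. 4.8] -/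
theorem not_dvd_card_range_stabDeriv : ¬ p ∣ Nat.card (stabDeriv H).range := by
  intro hdvd
  haveI : Finite (stabDeriv H).range := Finite.of_surjective _ (stabDeriv H).rangeRestrict_surjective
  obtain ⟨u, hu⟩ := exists_prime_orderOf_dvd_card' (G := (stabDeriv H).range) p hdvd
  have h1 : ((u : kˣ) : k) ^ (p ^ 1 * 1) = 1 := by
    rw [mul_one, pow_one, ← Units.val_pow_eq_pow_val, ← Subgroup.coe_pow, ← hu,
      pow_orderOf_eq_one, Subgroup.coe_one, Units.val_one]
  haveI := ExpChar.prime (R := k) (Fact.out : p.Prime)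
  have h2 : (u : kˣ) = 1 :=
    Units.ext (by simpa using (ExpChar.pow_prime_pow_mul_eq_one_iff p 1 1 _).mp h1)
  have h3 : u = 1 := Subtype.ext h2
  rw [h3, orderOf_one] at hu
  exact (Fact.out : p.Prime).one_lt.ne' hu.symm

/-! ### Normal `p`-subgroups -/

/-- **A finite subgroup of `PGL₂(k)` with a non-trivial normal `p`-subgroup fixes a point of
`ℙ¹(k)`** (`k` algebraically closed of characteristic `p`) — in particular a finite `H ≤ PGL₂(k)`
whose Sylow `p`-subgroup is normal and non-trivial lies in a Borel subgroup (Faber 2011,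
Cor. 4.10: "`P` must fix a unique point of `ℙ¹(k)`, and so must any group that normalizes it").
This is the group-theoretic content of "reducible or `p ∤ |image|`" dichotomies such as
Newton–Thorne II, Lemma 3.3 / Prop. 3.7. [cite: Faber2011, Cor. 4.10] -/
theorem exists_forall_smul_eq_of_normal [IsAlgClosed k] (N : Subgroup H) [N.Normal]
    (hN : IsPGroup p N) (hN1 : N ≠ ⊥) : ∃ x : OnePoint k, ∀ h ∈ H, h • x = x := by
  set N' : Subgroup PGL(Fin 2, k) := N.map H.subtype with hN'def
  have hle : N' ≤ H := Subgroup.map_subtype_le N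
  haveI : Finite N' := Finite.of_injective _ (Subgroup.inclusion_injective hle)
  have hN' : IsPGroup p N' := hN.map H.subtype
  have hN'1 : N' ≠ ⊥ := by
    intro h
    apply hN1
    rwa [hN'def, Subgroup.map_eq_bot_iff_of_injective N H.subtype_injective] at h
  obtain ⟨x, hx, hxu⟩ := exists_smul_eq_of_isPGroup p hN' hN'1
  refine ⟨x, fun h hh => ?_⟩
  obtain ⟨⟨s, hsN⟩, hs1⟩ := Subgroup.ne_bot_iff_exists_ne_one.mp hN1
  have hs1' : (s : PGL(Fin 2, k)) ≠ 1 := fun h' => hs1 (Subtype.ext (Subtype.ext h'))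
  set g : H := ⟨h, hh⟩ with hg
  have hs' : g⁻¹ * s * g⁻¹⁻¹ ∈ N := ‹N.Normal›.conj_mem s hsN g⁻¹
  rw [inv_inv] at hs'
  have hmem : ∀ t ∈ N, (t : PGL(Fin 2, k)) ∈ N' := fun t ht => Subgroup.mem_map.mpr ⟨t, ht, rfl⟩
  have h1 : (s : PGL(Fin 2, k)) • (h • x) = h • x := by
    have := hx _ (hmem _ hs')
    rw [Subgroup.coe_mul, Subgroup.coe_mul, Subgroup.coe_inv, mul_smul, mul_smul,
      inv_smul_eq_iff] at this
    exact this
  exact (hxu _ (hmem s hsN) hs1' _ h1).trans (hxu _ (hmem s hsN) hs1' x (hx _ (hmem s hsN))).symm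

/-- **A normal non-trivial Sylow `p`-subgroup forces a fixed point**: for a finite
`H ≤ PGL₂(k)` (`k` algebraically closed of characteristic `p`) with `p ∣ |H|` whose Sylow
`p`-subgroup is normal, all of `H` fixes a point of `ℙ¹(k)`. [cite: Faber2011, Cor. 4.10] -/
theorem exists_forall_smul_eq_of_sylow_normal [IsAlgClosed k] (P : Sylow p H)
    [(P : Subgroup H).Normal] (hdvd : p ∣ Nat.card H) :
    ∃ x : OnePoint k, ∀ h ∈ H, h • x = x :=
  exists_forall_smul_eq_of_normal p H P P.isPGroup' (P.ne_bot_of_dvd_card hdvd)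

end Finite

end CharPAction

end Literature.GroupTheory.SpecificGroups.PGL2
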